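import Mathlib
import HarnessLib

/-!
# Local perturbations of a determinant: the block (Sylvester / Lüscher) factorisation

Topic `Literature/Analysis/Matrix`; namespace `Literature.Analysis.Matrix`.  Everything here is
PROVED (no definitions, no named facts), over an arbitrary commutative ring.

If two square matrices `D, D'` over a commutative ring agree outside the block `S × S` of a finite
set `S` of indices and `D'` is invertible, then
`det D = det D' · det(1_S + (D'⁻¹)_{SS} (D − D')_{SS})`
(`det_eq_det_mul_det_one_add_block`): the RATIO of the two determinants is an `|S| × |S|`
determinant built from the entries of the reference inverse `D'⁻¹` INSIDE `S` and the perturbation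
inside `S`.  In lattice QCD this is the exact local factorisation of the quark determinant under a
change of the gauge links inside a region (the perturbation `D_W(U) − D_W(U')` of the Wilson–Dirac
operator is supported on the rows and columns of the sites touched), behind Lüscher's domain
decomposition / partial-determinant updates [Luscher2005, §3]; algebraically it is Sylvester's
determinant identity `det(1 + AB) = det(1 + BA)` (`Matrix.det_one_add_mul_comm`, [Sylvester1881])
applied to `D = D'(1 + D'⁻¹E)`, `E := D − D'`, with `A = (D'⁻¹E)|_{ι×S}` and `B` the inclusion
`S ↪ ι` (the rows of `E` off `S` vanish).

Also recorded: the same statement with the perturbation written as `E` (`det_add_eq_det_mul_det_one_add_block`).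
-/

namespace Literature.Analysis.Matrix

open Matrix

variable {R : Type*} [CommRing R] {ι : Type*} [Fintype ι] [DecidableEq ι]

/-- **Block factorisation of a locally perturbed determinant** (Sylvester; Lüscher's partial
determinant).  If `D` and `D'` agree outside `S × S` (`i ∉ S ∨ j ∉ S → D i j = D' i j`) and
`det D'` is a unit, then `det D = det D' · det(1_S + (D'⁻¹)_{SS} (D − D')_{SS})`.
[cite: Luscher2005, §3 (block decomposition of the quark determinant)] -/
theorem det_eq_det_mul_det_one_add_block (S : Finset ι) (D D' : Matrix ι ι R)
    (hD' : IsUnit D'.det) (hagree : ∀ i j, i ∉ S ∨ j ∉ S → D i j = D' i j) :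
    D.det = D'.det *
      ((1 : Matrix S S R) + (D'⁻¹.submatrix Subtype.val Subtype.val) *
        ((D - D').submatrix Subtype.val Subtype.val)).det := by
  set E : Matrix ι ι R := D - D' with hEdef
  have hEcol : ∀ i j, j ∉ S → E i j = 0 := fun i j hj => by
    simp only [hEdef, Matrix.sub_apply, hagree i j (Or.inr hj), sub_self]
  have hErow : ∀ i j, i ∉ S → E i j = 0 := fun i j hi => by
    simp only [hEdef, Matrix.sub_apply, hagree i j (Or.inl hi), sub_self]
  set N : Matrix ι ι R := D'⁻¹ * E with hNdef
  have hNcol : ∀ i j, j ∉ S → N i j = 0 := fun i j hj => by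
    simp only [hNdef, Matrix.mul_apply]
    exact Finset.sum_eq_zero fun l _ => by rw [hEcol l j hj, mul_zero]
  have hD : D = D' * (1 + N) := by
    rw [mul_add, mul_one, hNdef, ← mul_assoc, Matrix.mul_nonsing_inv _ hD', one_mul, hEdef,
      add_sub_cancel]
  set A : Matrix ι S R := N.submatrix id Subtype.val with hAdef
  set B : Matrix S ι R := (1 : Matrix ι ι R).submatrix Subtype.val id with hBdef
  have hAB : A * B = N := by
    ext i j
    simp only [Matrix.mul_apply, hAdef, hBdef, Matrix.submatrix_apply, id_eq, Matrix.one_apply,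
      mul_ite, mul_one, mul_zero]
    by_cases hj : j ∈ S
    · rw [Finset.sum_eq_single (⟨j, hj⟩ : S)]
      · simp
      · intro b _ hb
        rw [if_neg]
        exact fun h => hb (Subtype.ext h)
      · intro h
        exact absurd (Finset.mem_univ _) h
    · rw [hNcol i j hj]
      refine Finset.sum_eq_zero fun x _ => ?_
      rw [if_neg]
      intro h
      exact hj (h ▸ x.2)
  have hBA : B * A = (D'⁻¹.submatrix Subtype.val Subtype.val) * (E.submatrix Subtype.val Subtype.val) := by
    ext s t
    simp only [Matrix.mul_apply, hAdef, hBdef, hNdef, Matrix.submatrix_apply, id_eq, Matrix.one_apply,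
      ite_mul, one_mul, zero_mul]
    rw [Finset.sum_ite_eq, if_pos (Finset.mem_univ _)]
    have hsub : ∑ u : ↥S, D'⁻¹ (s : ι) u * E u (t : ι) = ∑ l ∈ S, D'⁻¹ (s : ι) l * E l (t : ι) :=
      Finset.sum_coe_sort S (fun l => D'⁻¹ (s : ι) l * E l (t : ι))
    rw [hsub]
    exact (Finset.sum_subset (Finset.subset_univ S) fun l _ hl => by rw [hErow l _ hl, mul_zero]).symm
  calc D.det = D'.det * (1 + N).det := by rw [hD, Matrix.det_mul]
    _ = D'.det * (1 + A * B).det := by rw [hAB]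
    _ = D'.det * (1 + B * A).det := by rw [Matrix.det_one_add_mul_comm]
    _ = _ := by rw [hBA]

/-- **The same factorisation for `D' + E` with `E` supported in the block `S × S`**:
`det(D' + E) = det D' · det(1_S + (D'⁻¹)_{SS} E_{SS})`.
[cite: Luscher2005, §3 (block decomposition of the quark determinant)] -/
theorem det_add_eq_det_mul_det_one_add_block (S : Finset ι) (D' E : Matrix ι ι R)
    (hD' : IsUnit D'.det) (hE : ∀ i j, i ∉ S ∨ j ∉ S → E i j = 0) :
    (D' + E).det = D'.det *
      ((1 : Matrix S S R) + (D'⁻¹.submatrix Subtype.val Subtype.val) *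
        (E.submatrix Subtype.val Subtype.val)).det := by
  have h := det_eq_det_mul_det_one_add_block S (D' + E) D' hD'
    (fun i j hij => by rw [Matrix.add_apply, hE i j hij, add_zero])
  rwa [add_sub_cancel_left] at h

end Literature.Analysis.Matrix
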